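import Literature.NumberTheory.Automorphic.UnitaryGroupDiagTraceExpansion
import HarnessLib

/-!
# Orbital terms of the anisotropic inner form `U(H)`: the NAMED property `IsOrbitalTerms` and
`θ_{G′}(F) = Σ_{𝒪_st} J(𝒪_st, F)` with genuine orbital terms
(Rogawski, *Automorphic representations of unitary groups in three variables* (1990), §14.5 p. 237
(print): `J_{G′}(f′) = Σ_γ (…) Φ(γ, f′)`, `Φ(γ, f′)` the orbital integral of `f′` at `γ`, grouped as
`J(𝒪_st, f′)` over the conjugacy classes inside a stable class)

Topic `NumberTheory/Automorphic`; namespace `Literature.NumberTheory.Automorphic.UnitaryGroup`. One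
definition (`IsOrbitalTerms`, a `Prop`) and theorems; no instance, no instance attribute, no `sorry`;
imports = tree.

`UnitaryGroupDiagTraceExpansion` proves that the trace functional `UnitaryGroup.diagTrace` of the
inner form is a finite sum of stable orbital sums of a class function `Φ F` — existentially. A kit pin
«`J 𝒪_st f′ = 𝒪_st.orbitalSum (Φ f′)` for SOME `Φ` with that identity» would be contentless (the junk
`Φ F := θ(F) · 𝟙_{[1]}` satisfies it), so this file NAMES what the genuine `Φ` is:

* `UnitaryGroup.IsOrbitalTerms L N H Φ` (**definition**): there are a bijection `e` from the conjugacy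
  classes of `U(H)(L⁺)` to those of its diagonal image in `U(H)(𝔸_{L⁺})` with `e [γ] = [toAdelic γ]`,
  a constant `C > 0`, weights `d_c ∈ (0, ∞)` and non-zero `U(H)(𝔸)`-invariant Borel measures `μ_c`,
  finite on compact sets, on `U(H)(𝔸) ⧸ U(H)(𝔸)_{γ_c}` (`γ_c = out c`, Borel σ-algebras), such that
  `Φ F [γ] = C · d_{e[γ]} · ∫ F(y γ_{e[γ]} y⁻¹) dμ_{e[γ]}(y)` for all `F`, `[γ]` — "`Φ F [γ]` is a positive
  constant times a genuine invariant orbital integral of `F` over the class of `γ`". The quotient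
  σ-algebras are fixed to `borel` inside the definition, so the `Prop` carries no instance parameters.
* `UnitaryGroup.IsOrbitalTerms.finite_support` — such a `Φ F` is finitely supported for every
  `F ∈ C_c` (`UnitaryGroupOrbitalFiniteness`, any measures);
* `UnitaryGroup.exists_isOrbitalTerms_diagTrace_eq_finsum_stableClass` — **for `H` anisotropic there
  IS a `Φ` with `IsOrbitalTerms Φ` and `θ(F) = Σᶠ_{𝒪_st} 𝒪_st.orbitalSum (Φ F)` for every `F`** (both
  supports finite) — the law `SimpleTraceFormula` of the floor-0 line for the anchored kit, with the
  orbital terms certified genuine [Rogawski1990, §14.5 p. 237 (print)].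

CAVEAT (inherited): `C`, `d_c`, `μ_c` are not normalised (the printed coefficients are Tamagawa-type
volumes `a_γ`).

## References

* J. D. Rogawski, *Automorphic Representations of Unitary Groups in Three Variables*, Ann. of Math.
  Stud. 123 (1990), §14.5 p. 237 (print) [Rogawski1990].
* S. Gelbart, *Automorphic forms on adele groups*, Ann. of Math. Stud. 83 (1975), (9.13), Remark 9.23
  [Gelbart1975].
-/

noncomputable section

open MeasureTheory Measure Set Filter Topology NumberField CompactlySupported
open Literature.MeasureTheory.Group
open scoped ENNReal NNReal Pointwise

namespace Literature.NumberTheory.Automorphic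

namespace UnitaryGroup

open Literature.AlgebraicGeometry.ShimuraVarieties (hermForm)

section Def

variable (L : Type) [Field L] [NumberField L] [IsCMField L] (N : ℕ) (H : Matrix (Fin N) (Fin N) L)

/-- **Genuine orbital terms** for a family of class functions `Φ F : ConjClasses U(H)(L⁺) → ℂ`
(`F ∈ C_c(U(H)(𝔸_{L⁺}))`): there are a bijection `e` from the conjugacy classes of the rational group
`U(H)(L⁺)` to those of its diagonal image in `U(H)(𝔸_{L⁺})` with `e [γ] = [toAdelic γ]`, a constant
`C > 0`, weights `d_c ∈ (0, ∞)` and non-zero `U(H)(𝔸_{L⁺})`-invariant Borel measures `μ_c` finite on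
compact sets on `U(H)(𝔸) ⧸ U(H)(𝔸)_{γ_c}` (`γ_c = out c` a representative, `U(H)(𝔸)_{γ_c}` its adelic
centraliser; Borel σ-algebras, fixed here) such that for all `F` and `[γ]`

  `Φ F [γ] = C · d_{e[γ]} · ∫_{U(H)(𝔸) ⧸ U(H)(𝔸)_{γ}} F(y γ y⁻¹) dμ_{e[γ]}(y)`

(`γ = γ_{e[γ]}`): `Φ F [γ]` is a positive constant times a genuine invariant orbital integral of `F`
at `γ` — Rogawski's `Φ(γ, f′)` with its coefficient [§14.5 p. 237 (print)], up to the normalisation of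
constants and measures (not made here). [cite: Rogawski1990, §14.5 p. 237] -/
def IsOrbitalTerms
    (Φ : C_c((cmDatum L N H).Adelic, ℂ) → ConjClasses (cmDatum L N H).Rational → ℂ) : Prop :=
  letI : ∀ γ : (cmDatum L N H).Adelic, MeasurableSpace ((cmDatum L N H).Adelic ⧸
      Subgroup.centralizer ({γ} : Set (cmDatum L N H).Adelic)) := fun _ => borel _
  ∃ (e : ConjClasses (cmDatum L N H).Rational ≃ ConjClasses (cmDatum L N H).arithmeticSubgroup)
    (C : ℝ≥0) (dc : ConjClasses (cmDatum L N H).arithmeticSubgroup → ℝ≥0∞)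
    (μC : ∀ c : ConjClasses (cmDatum L N H).arithmeticSubgroup, Measure ((cmDatum L N H).Adelic ⧸
      Subgroup.centralizer ({((Quotient.out c : (cmDatum L N H).arithmeticSubgroup) :
        (cmDatum L N H).Adelic)} : Set (cmDatum L N H).Adelic))),
    (∀ γ : (cmDatum L N H).Rational, e (ConjClasses.mk γ) =
      ConjClasses.mk ⟨(cmDatum L N H).toAdelic γ, ⟨γ, rfl⟩⟩) ∧
    0 < C ∧ (∀ c, dc c ≠ 0 ∧ dc c ≠ ∞) ∧
    (∀ c, SMulInvariantMeasure (cmDatum L N H).Adelic _ (μC c) ∧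
      IsFiniteMeasureOnCompacts (μC c) ∧ μC c ≠ 0) ∧
    ∀ (F : C_c((cmDatum L N H).Adelic, ℂ)) (c : ConjClasses (cmDatum L N H).Rational),
      Φ F c = ((C : ℝ) : ℂ) * ((dc (e c)).toReal : ℂ) * ∫ y, descConj
        ((Quotient.out (e c) : (cmDatum L N H).arithmeticSubgroup) : (cmDatum L N H).Adelic)
        (Subgroup.centralizer ({((Quotient.out (e c) : (cmDatum L N H).arithmeticSubgroup) :
          (cmDatum L N H).Adelic)} : Set (cmDatum L N H).Adelic))
        (fun _ hg => Subgroup.mem_centralizer_singleton_iff.1 hg) F y ∂(μC (e c))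

/-- **Genuine orbital terms are finitely supported** for every test function (`H` anisotropic): off
the finitely many classes meeting `tsupport F` under conjugation the orbital integrands vanish
identically (`exists_finset_descConj_eq_zero_cmDatum`, any measures). [cite: Rogawski1990, §14.5 p. 237] -/
theorem IsOrbitalTerms.finite_support
    {Φ : C_c((cmDatum L N H).Adelic, ℂ) → ConjClasses (cmDatum L N H).Rational → ℂ}
    (hΦ : IsOrbitalTerms L N H Φ)
    (hanis : ∀ x : Fin N → L, hermForm (cmConjRingHom L) H x x = 0 → x = 0)
    (F : C_c((cmDatum L N H).Adelic, ℂ)) : (Function.support (Φ F)).Finite := by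
  letI : ∀ γ : (cmDatum L N H).Adelic, MeasurableSpace ((cmDatum L N H).Adelic ⧸
      Subgroup.centralizer ({γ} : Set (cmDatum L N H).Adelic)) := fun _ => borel _
  unfold IsOrbitalTerms at hΦ
  obtain ⟨e, C, dc, μC, -, -, -, -, hΦF⟩ := hΦ
  obtain ⟨s, hs⟩ := exists_finset_descConj_eq_zero_cmDatum L N H hanis F
    (fun c => Subgroup.centralizer ({((Quotient.out c : (cmDatum L N H).arithmeticSubgroup) :
      (cmDatum L N H).Adelic)} : Set (cmDatum L N H).Adelic))
    (fun c => fun _ hg => Subgroup.mem_centralizer_singleton_iff.1 hg)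
  refine ((s.finite_toSet.preimage e.injective.injOn)).subset fun c hc => ?_
  by_contra hcs
  refine hc ?_
  rw [hΦF F c, hs (e c) hcs, Pi.zero_def, integral_zero, mul_zero]

end Def

section Expansion

variable (L : Type) [Field L] [NumberField L] [IsCMField L] (N : ℕ) (H : Matrix (Fin N) (Fin N) L)
  [MeasurableSpace (cmDatum L N H).Adelic] [BorelSpace (cmDatum L N H).Adelic]
  (μ : Measure (cmDatum L N H).automorphicQuotient) [(cmDatum L N H).IsAutomorphicMeasure μ]
  (ν : Measure (cmDatum L N H).Adelic) [ν.IsHaarMeasure]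

/-- **`θ_{G′}(F) = Σ_{𝒪_st} J(𝒪_st, F)` with GENUINE orbital terms** (Rogawski (1990), §14.5 p. 237
(print)): for `H` anisotropic, `μ` automorphic and `ν` a Haar measure on `U(H)(𝔸_{L⁺})` there is a
family of class functions `Φ` with `IsOrbitalTerms L N H Φ` such that for every
`F ∈ C_c(U(H)(𝔸_{L⁺}))`: `Φ F` and `𝒪_st ↦ 𝒪_st.orbitalSum (Φ F)` are finitely supported and

  `UnitaryGroup.diagTrace L N H μ ν hanis F = Σᶠ_{𝒪_st} 𝒪_st.orbitalSum (Φ F)`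

(`diagTrace_eq_finsum_stableClass_orbitalSum` of `UnitaryGroupDiagTraceExpansion` for the Borel
σ-algebras on the orbit spaces). With `StClass := StableClass (cmConjRingHom L) H` and
`J 𝒪_st f′ := 𝒪_st.orbitalSum (Φ f′)` this is the law `SimpleTraceFormula` of the floor-0 line for
the anchored kit, the orbital terms being certified genuine by `IsOrbitalTerms`.
[cite: Rogawski1990, §14.5 p. 237] -/
theorem exists_isOrbitalTerms_diagTrace_eq_finsum_stableClass
    (hanis : ∀ x : Fin N → L, hermForm (cmConjRingHom L) H x x = 0 → x = 0) :
    ∃ Φ : C_c((cmDatum L N H).Adelic, ℂ) → ConjClasses (cmDatum L N H).Rational → ℂ,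
      IsOrbitalTerms L N H Φ ∧
      ∀ F : C_c((cmDatum L N H).Adelic, ℂ),
        (Function.support (Φ F)).Finite ∧
        (Function.support fun st : Literature.NumberTheory.Rogawski1990.StableClass (cmConjRingHom L) H =>
          st.orbitalSum (Φ F)).Finite ∧
        diagTrace L N H μ ν hanis F =
          ∑ᶠ st : Literature.NumberTheory.Rogawski1990.StableClass (cmConjRingHom L) H,
            st.orbitalSum (Φ F) := by
  letI : ∀ γ : (cmDatum L N H).Adelic, MeasurableSpace ((cmDatum L N H).Adelic ⧸
      Subgroup.centralizer ({γ} : Set (cmDatum L N H).Adelic)) := fun _ => borel _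
  haveI : ∀ γ : (cmDatum L N H).Adelic, BorelSpace ((cmDatum L N H).Adelic ⧸
      Subgroup.centralizer ({γ} : Set (cmDatum L N H).Adelic)) := fun _ => ⟨rfl⟩
  obtain ⟨e, C, dc, μC, he, hC, hdc, hμC, hF⟩ :=
    diagTrace_eq_finsum_stableClass_orbitalSum L N H μ ν hanis
  refine ⟨fun F c => ((C : ℝ) : ℂ) * ((dc (e c)).toReal : ℂ) * ∫ y, descConj
      ((Quotient.out (e c) : (cmDatum L N H).arithmeticSubgroup) : (cmDatum L N H).Adelic)
      (Subgroup.centralizer ({((Quotient.out (e c) : (cmDatum L N H).arithmeticSubgroup) :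
        (cmDatum L N H).Adelic)} : Set (cmDatum L N H).Adelic))
      (fun _ hg => Subgroup.mem_centralizer_singleton_iff.1 hg) F y ∂(μC (e c)),
    ?_, fun F => ?_⟩
  · unfold IsOrbitalTerms
    exact ⟨e, C, dc, μC, he, hC, hdc, hμC, fun _ _ => rfl⟩
  obtain ⟨hfin, hEq⟩ := hF F
  exact ⟨hfin, Literature.NumberTheory.Rogawski1990.StableClass.finite_support_orbitalSum _ hfin, hEq⟩

end Expansion

end UnitaryGroup

end Literature.NumberTheory.Automorphic
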